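import Literature.MathematicalPhysics.QuantumFieldTheory.Balaban1983to89.B1Eq324BenfattoKernelSect5Eq536
import Literature.MathematicalPhysics.QuantumFieldTheory.Balaban1983to89.B1Eq324BenfattoKernelSect5PavementStep
import Literature.MathematicalPhysics.QuantumFieldTheory.Balaban1983to89.B1Eq324BenfattoSect5Eq536
import HarnessLib

/-!
# `Balaban1983to89.B1Eq324BenfattoKernelSect5UpperStep` — [BenfattoEtAl1978] §5 p. 159, (5.36) → «the r.h.s. of (5.35) with b replaced by γ⁻¹b»:
# ONE FULL PAVEMENT STEP OF THE UPPER BOUND (4.6) under the conditioned measure `P̄ = P̂₀(·|z̄_C)`, FOR THE CLASS of [Balaban1985BackgroundPropagators]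
# Sect. E p. 428 — per-box UPPER bounds as hypotheses in the part-field currency; price `2(ρ + T/2)` per step; PROVED

statement-level skeleton of published theorems with citation tags; proofs where landed; nothing here is a claim about the
Yang–Mills mass gap

WHY THIS MODULE (cell `pub-ymgap`, seat `dag-n08-d` gen 13, INTENT-57; node N08 [Balaban1985UV3]; the [BenfattoEtAl1978] source chain behind the
(α)-row `h324`; row S7 of `N08-PORT-MAP-STRUCTURAL-SIDE.md`, second half).  Print, p. 159: *"[(5.12)] ≦ ∫P̄(dz_{Γ₁})χ^{Γ₁}_b exp H_{Γ₁}(Π ∫P̄(dz_□|z_{Γ₁})χ^□_b)·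
(Π ∫P̄(dz_□|z_{Γ₁}) exp Ψ_□χ^□_b) (5.36) By beeing careful in attributing to the various τ the value opposite to the one chosen in the estimate (4.7) we obtain
that (5.12) can be bounded above by the r.h.s. of (5.35) with b replaced by γ⁻¹b"*.  The concrete `…Sect5Eq536.upperPavementStep_cond_of_setIntegral_gamma`
(this seat, gen 9) chains this under [2]'s free field: (5.11) upwards, the factorisation identity, per-box UPPER bounds (hypotheses), the identity backwards,
(5.34) upwards.  For the class both uses of the identity become the two-sided comparison of `…KernelSect5Eq536` (`integral_boxes_factorise_cond_le` going
to the factorised form, `integral_boxes_factorise_cond_ge` coming back), each at the price `e^{ρ+T/2}`, with the SAME part fields on both sides — the loop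
closes for the upper chain exactly as `…KernelSect5PavementStep.pavementStep` closes it for the lower one.

OBJECTS (all displayed; no definition is made): as in `…KernelSect5Eq536` (conditioning set `C`, outer datum `z̄` small on `C`, index set `Λ ∖ (C ∪ Γ₁)`, parts
`shrink L m w ∖ C` and the far part, rows `hπ hr hrmax hγr hKb hKout hu hT`) plus the inner-corridor width `v ≤ w`, the family `B ⊇ J.image (boxIndex L)`,
§5's `Ψ′₁`, `Ψ₂`, `Γ̄₁ = corridorsBar L w v B`, `restrictCoef`.

WHAT IS PROVED (standard axioms; no `sorry`; no definition).
* ★★★ `upperPavementStep_cond_of_setIntegral` — for the class kernel `hK` of a symmetric `γ_A`-coercive `A` on `Λ ⊇ C ∪ Γ₁` and the boxes of `B`, `L ≥ 1`,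
  `v ≤ w`, `γ ≤ 1 ≤ γb`, `J ⊆ I`, `B ⊇` the tesserae meeting `J`, `z̄` small on `C` (threshold `b`), and PER-BOX UPPER BOUNDS in the part-field currency,
  `∫_{χ^□_b} e^{Ψ_□} dN^K_{□∖C,ξ} ≤ e^{u_□}·∫_{χ^□_b} e^{Ψ′₁+Ψ₂} dN^K_{□∖C,ξ}` for every `□ ∈ B` and every `ξ` small on `Γ₁` (`γb`) and on `C` (`b`):
  `∫ Π_Δχ̂^{γb}_Δ e^{H^A_J} dP̄^K_{C,z̄} ≤ exp(err₅₁₁(γb) + err₅₃₄(b) + 2(ρ + T/2) + Σ_{□∈B}u_□)·∫ Π_Δχ̂^{b}_Δ e^{H^{A|Γ̄₁}_{J∩Γ̄₁}} dP̄^K_{C,z̄}`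
  (INPUT cut-offs at `γb`, box interiors ∕ far block ∕ OUTPUT at `b`; `ρ = Σ_y r_y/(γ_A − r_max)`).
HONEST SCOPE.  Assembly over `…KernelSect5Eq536` ∕ p609780 ∕ p609197 and the kernel-free §5 algebra of this seat's gen-8/9 modules; the class, the
substitute for (5.13) and the bounded-fluctuation device are OURS (a reading of [Balaban1985BackgroundPropagators] p. 428 for [Balaban1982Higgs1] p. 616),
not print; the per-box upper bounds (hence `u_□`) are hypotheses; the displaced-pavement chain, `b*` and the assembly of (4.6) are NOT here; nothing of
[Balaban1985UV3] / [Balaban1985UV2] is asserted; no generalised Basic Lemma is stated; the port is not commissioned and nothing beyond this step is chained;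
count-neutral for N08; nothing about d = 4, the continuum, OS axioms, a mass gap or the Clay problem.
-/

noncomputable section

open MeasureTheory ProbabilityTheory Finset Matrix WithLp
open scoped BigOperators Matrix NNReal ENNReal

namespace Literature.MathematicalPhysics.QuantumFieldTheory.Balaban1983to89.B1Eq324BenfattoKernelSect5UpperStep

open Literature.MathematicalPhysics.QuantumFieldTheory
open Literature.MathematicalPhysics.QuantumFieldTheory.GaussianToolkit
open Literature.MathematicalPhysics.QuantumFieldTheory.Balaban1983to89.B1Eq324BenfattoLemma
open Literature.MathematicalPhysics.QuantumFieldTheory.Balaban1983to89.B1Eq324BenfattoKernelRegression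
open Literature.MathematicalPhysics.QuantumFieldTheory.Balaban1983to89.B1Eq324BenfattoKernelOfPrecision
open Literature.MathematicalPhysics.QuantumFieldTheory.Balaban1983to89.B1Eq324BenfattoKernelCondField
open Literature.MathematicalPhysics.QuantumFieldTheory.Balaban1983to89.B1Eq324BenfattoKernelSect5Eq513
open Literature.MathematicalPhysics.QuantumFieldTheory.Balaban1983to89.B1Eq324BenfattoKernelSect5Eq515
open Literature.MathematicalPhysics.QuantumFieldTheory.Balaban1983to89.B1Eq324BenfattoKernelSect5Eq536
open Literature.MathematicalPhysics.QuantumFieldTheory.Balaban1983to89.B1Eq324BenfattoClassAppendixC (posDef_of_coercive)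
open Literature.MathematicalPhysics.QuantumFieldTheory.Balaban1983to89.B1Eq324BenfattoAppendixA (distToRegion_nonneg)
open Literature.MathematicalPhysics.QuantumFieldTheory.Balaban1983to89.B1Eq324BenfattoSect5Boxes
open Literature.MathematicalPhysics.QuantumFieldTheory.Balaban1983to89.B1Eq324BenfattoSect5Eq511 (s1Const abs_Hl_le_of_range)
open Literature.MathematicalPhysics.QuantumFieldTheory.Balaban1983to89.B1Eq324BenfattoSect5Eq524 (psi1p psi2)
open Literature.MathematicalPhysics.QuantumFieldTheory.Balaban1983to89.B1Eq324BenfattoSect5Eq534 (corridorsBar abs_hamiltonian_corridorsBar_sub_sum_psi_le abs_hamiltonian_le)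
open Literature.MathematicalPhysics.QuantumFieldTheory.Balaban1983to89.B1Eq324BenfattoSect5Eq535 (abs_psi1p_add_psi2_le_local psi1p_add_psi2_congr_eqOn measurable_psi1p_add_psi2)
open Literature.MathematicalPhysics.QuantumFieldTheory.Balaban1983to89.B1Eq324BenfattoSect5Iteration (restrictCoef cutoffBoltzmann_hamiltonian_eq_restrict measurable_cutoffBoltzmann_hamiltonian)
open Literature.MathematicalPhysics.QuantumFieldTheory.Balaban1983to89.B1Eq324BenfattoSect5Eq515
open Literature.MathematicalPhysics.QuantumFieldTheory.Balaban1983to89.B1Eq324BenfattoSect5Eq536 (integrable_boxes_integrand_of indicator_smallFieldSet_le_prod_gamma)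
open Literature.MathematicalPhysics.QuantumFieldTheory.Balaban1983to89.B1Eq324BenfattoSect5SlotMoments (distToRegion_eq_zero_of_mem)

variable {d : ℕ}

section Main

variable {Λ : Finset (B1Eq324BenfattoLemma.Site d)} {A : Matrix Λ Λ ℝ}
  {K : B1Eq324BenfattoLemma.Site d → B1Eq324BenfattoLemma.Site d → ℝ}
  (hK : ∀ x y, K x y = if h : x ∈ Λ ∧ y ∈ Λ then (A⁻¹ : Matrix Λ Λ ℝ) ⟨x, h.1⟩ ⟨y, h.2⟩ else 0)
  {s D : ℕ} {κ : ℝ} {a : Coef d} {J I : Finset (B1Eq324BenfattoLemma.Site d)} {L w v : ℕ} {B C : Finset (B1Eq324BenfattoLemma.Site d)}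
  {γ b Ac : ℝ}
  (hAs : ∀ e e', A e e' = A e' e) {γA rmax : ℝ} (hγA0 : 0 < γA)
  (hγA : ∀ x : Λ → ℝ, γA * ∑ e, x e ^ 2 ≤ ∑ e, ∑ e', A e e' * x e * x e')
  (hJI : J ⊆ I) (hL : 0 < L) (hγ1 : γ ≤ 1) (hb : 1 ≤ b)
  (hSΛ : C ∪ corridors L w B ⊆ Λ) (hBΛ : ∀ m ∈ B, box L m ⊆ Λ)
  (π : ↥(Λ \ (C ∪ corridors L w B)) → Option ↥B)
  (hπ : ∀ (y : ↥(Λ \ (C ∪ corridors L w B))) (m : ↥B), π y = some m ↔ (y : B1Eq324BenfattoLemma.Site d) ∈ shrink L (m : B1Eq324BenfattoLemma.Site d) w)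
  (r : ↥(Λ \ (C ∪ corridors L w B)) → ℝ)
  (hr : ∀ y : ↥(Λ \ (C ∪ corridors L w B)), ∑ y' : ↥(Λ \ (C ∪ corridors L w B)), (if π y = π y' then (0 : ℝ) else
    |A ⟨y, (Finset.mem_sdiff.mp y.2).1⟩ ⟨y', (Finset.mem_sdiff.mp y'.2).1⟩|) ≤ r y)
  (hrmax : ∀ y, r y ≤ rmax) (hγr : rmax < γA)
  {Kb : B1Eq324BenfattoLemma.Site d → B1Eq324BenfattoLemma.Site d → B1Eq324BenfattoLemma.Site d → ℝ}
  (hKb : ∀ m (hm : m ∈ B) x y, Kb m x y = if h : x ∈ shrink L m w \ C ∧ y ∈ shrink L m w \ C then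
    ((A.submatrix (fun j : ↥(shrink L m w \ C) => (⟨j, hBΛ m hm (shrink_subset_box L m w (Finset.mem_sdiff.mp j.2).1)⟩ : Λ))
      (fun j : ↥(shrink L m w \ C) => (⟨j, hBΛ m hm (shrink_subset_box L m w (Finset.mem_sdiff.mp j.2).1)⟩ : Λ)))⁻¹ :
        Matrix ↥(shrink L m w \ C) ↥(shrink L m w \ C) ℝ) ⟨x, h.1⟩ ⟨y, h.2⟩ else 0)
  {Kout : B1Eq324BenfattoLemma.Site d → B1Eq324BenfattoLemma.Site d → ℝ}
  (hKout : ∀ x y, Kout x y =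
    if h : x ∈ ((Λ \ (C ∪ corridors L w B)).filter fun x => ∀ m ∈ B, x ∉ box L m) ∧
        y ∈ ((Λ \ (C ∪ corridors L w B)).filter fun x => ∀ m ∈ B, x ∉ box L m) then
      ((A.submatrix
          (fun j : ↥((Λ \ (C ∪ corridors L w B)).filter fun x => ∀ m ∈ B, x ∉ box L m) =>
            (⟨j, (Finset.mem_sdiff.mp (Finset.mem_filter.mp j.2).1).1⟩ : Λ))
          (fun j : ↥((Λ \ (C ∪ corridors L w B)).filter fun x => ∀ m ∈ B, x ∉ box L m) =>
            (⟨j, (Finset.mem_sdiff.mp (Finset.mem_filter.mp j.2).1).1⟩ : Λ)))⁻¹ :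
        Matrix ↥((Λ \ (C ∪ corridors L w B)).filter fun x => ∀ m ∈ B, x ∉ box L m)
          ↥((Λ \ (C ∪ corridors L w B)).filter fun x => ∀ m ∈ B, x ∉ box L m) ℝ) ⟨x, h.1⟩ ⟨y, h.2⟩ else 0)
  {Cu : ℝ}
  (hu : ∀ ξ ∈ smallFieldOn (corridors L w B : Set (B1Eq324BenfattoLemma.Site d)) I (γ * b), ξ ∈ smallFieldOn (C : Set (B1Eq324BenfattoLemma.Site d)) I b →
    ∀ y ∈ Λ \ (C ∪ corridors L w B), |condMean K (C ∪ corridors L w B) ξ y| ≤ Cu * b * (1 + distToRegion I y))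
  {T : ℝ} (hT : (1 + Cu) ^ 2 * b ^ 2 * ∑ y : ↥(Λ \ (C ∪ corridors L w B)), r y * (1 + distToRegion I y) ^ 2 ≤ T)

include hK hAs hγA0 hγA hJI hL hγ1 hb hSΛ hBΛ hπ hr hrmax hγr hKb hKout hu hT

/-- **THE UPPER PAVEMENT STEP UNDER `P̄^K_{C,z̄}`, WITH PRINT'S `γ`, FOR THE CLASS** («the r.h.s. of (5.35) with b replaced by γ⁻¹b», p. 159): INPUT
cut-offs at threshold `γb` (corridor data `χ^{Γ₁}_{γb}`, `χ^{Γ₁(□)}_{γb}`), box interiors and the far block at threshold `b`, OUTPUT at threshold `b`;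
per-box UPPER bounds in the part-field currency (set-integral form, the 5th-conjunct shape of the per-box line's `perBox_condField`) at every `□ ∈ B` and
every `ξ` small on `Γ₁` (`γb`) and on `C` (`b`):
`∫ Π_Δχ̂^{γb}_Δ e^{H^A_J} dP̄^K_{C,z̄} ≤ exp(err₅₁₁(γb) + err₅₃₄(b) + 2(ρ + T/2) + Σ_{□∈B}u_□)·∫ Π_Δχ̂^{b}_Δ e^{H^{A|Γ̄₁}_{J∩Γ̄₁}} dP̄^K_{C,z̄}`.
Chain: (5.11) upwards (pointwise, `…Sect5Eq511.abs_Hl_le_of_range` at threshold `γb ≥ 1`); the factorised form at γ dominates `Π_Δχ̂^{γb}e^{Ĥ}` pointwise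
(`indicator_smallFieldSet_le_prod_gamma`); `integral_boxes_factorise_cond_le` (price `e^{ρ+T/2}`); the per-box upper bounds inside the `ξ`-integral
(`boxFactor_eq_setIntegral_cond`, `P̄^K_{C,z̄}`-a.s. the datum is small on `C`); `integral_boxes_factorise_cond_ge` backwards (price `e^{ρ+T/2}`); (5.34)
upwards pointwise (`…Sect5Eq534.abs_hamiltonian_corridorsBar_sub_sum_psi_le`); the next datum (`cutoffBoltzmann_hamiltonian_eq_restrict`).  The free-field
statement replaced is `…Sect5Eq536.upperPavementStep_cond_of_setIntegral_gamma`.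
[cite: BenfattoEtAl1978, §5 (5.36) p.159, (4.6) p.152 (class substitute at temperature zero; ours)] -/
theorem upperPavementStep_cond_of_setIntegral (hκ : 0 < κ) (hJ : CoefSupportedIn a J) (hAc0 : 0 ≤ Ac)
    (hAc : ∀ p ∈ Finset.Icc 1 s, ∀ (Δ : Fin p → B1Eq324BenfattoLemma.Site d), (∀ i, Δ i ∈ J) →
      ∀ n ∈ admissible p D, |a p Δ n| ≤ Ac) (hv : v ≤ w) (hB : J.image (boxIndex L) ⊆ B) (hγb : 1 ≤ γ * b)
    (zbar : B1Eq324BenfattoLemma.Site d → ℝ) (hzbar : zbar ∈ smallFieldOn (C : Set (B1Eq324BenfattoLemma.Site d)) I b) (u : B1Eq324BenfattoLemma.Site d → ℝ)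
    (hbox : ∀ m ∈ B, ∀ ξ : B1Eq324BenfattoLemma.Site d → ℝ, ξ ∈ smallFieldOn (corridors L w B : Set (B1Eq324BenfattoLemma.Site d)) I (γ * b) →
      ξ ∈ smallFieldOn (C : Set (B1Eq324BenfattoLemma.Site d)) I b →
      ∫ z in smallFieldOn (shrink L m w : Set (B1Eq324BenfattoLemma.Site d)) I b, Real.exp (psiBox s D κ a L w m z) ∂((gaussianFieldOfKernel (Kb m)).map
              fun (ζ : B1Eq324BenfattoLemma.Site d → ℝ) (x : B1Eq324BenfattoLemma.Site d) => condMean K (C ∪ corridors L w B) ξ x + ζ x)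
        ≤ Real.exp (u m) * ∫ z in smallFieldOn (shrink L m w : Set (B1Eq324BenfattoLemma.Site d)) I b,
          Real.exp (psi1p s D κ a L w v m z + psi2 s D κ a L w m z) ∂((gaussianFieldOfKernel (Kb m)).map
              fun (ζ : B1Eq324BenfattoLemma.Site d → ℝ) (x : B1Eq324BenfattoLemma.Site d) => condMean K (C ∪ corridors L w B) ξ x + ζ x)) :
    ∫ z, cutoffBoltzmann (hamiltonian s D κ a J) I (γ * b) z ∂((gaussianFieldOfKernel (condCov K C)).map
          fun (ζ : B1Eq324BenfattoLemma.Site d → ℝ) (x : B1Eq324BenfattoLemma.Site d) => condMean K C zbar x + ζ x) ≤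
      Real.exp (s1Const s D d κ * Ac * (γ * b) ^ D * Real.exp (-(κ / 4 * w)) * J.card
        + s1Const s D d κ * Ac * b ^ D *
          (Real.exp (-(κ / 4 * w)) * (corridorsBar L w v B).card + Real.exp (-(κ / 4 * v)) * (B.card * (L : ℝ) ^ d))
        + 2 * ((∑ y, r y) / (γA - rmax) + T / 2) + ∑ m ∈ B, u m) *
        ∫ z, cutoffBoltzmann (hamiltonian s D κ (restrictCoef a (corridorsBar L w v B)) (J ∩ corridorsBar L w v B)) I b z ∂((gaussianFieldOfKernel (condCov K C)).map
          fun (ζ : B1Eq324BenfattoLemma.Site d → ℝ) (x : B1Eq324BenfattoLemma.Site d) => condMean K C zbar x + ζ x) := by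
  classical
  have hA : A.PosDef := posDef_of_coercive hAs hγA0 hγA
  have hKpsd : IsPosSemidefKernel K := isPosSemidefKernel_kernel hK hA
  have hCΛ : C ⊆ Λ := Finset.subset_union_left.trans hSΛ
  have hdetC : IsUnit (covGram K C).det := isUnit_det_covGram_kernel hK hA hCΛ
  haveI : IsProbabilityMeasure ((gaussianFieldOfKernel (condCov K C)).map
          fun (ζ : B1Eq324BenfattoLemma.Site d → ℝ) (x : B1Eq324BenfattoLemma.Site d) => condMean K C zbar x + ζ x) := isProbabilityMeasure_condFieldK hKpsd C hdetC zbar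
  set e511 : ℝ := s1Const s D d κ * Ac * (γ * b) ^ D * Real.exp (-(κ / 4 * w)) * J.card with he511
  set e534 : ℝ := s1Const s D d κ * Ac * b ^ D *
          (Real.exp (-(κ / 4 * w)) * (corridorsBar L w v B).card + Real.exp (-(κ / 4 * v)) * (B.card * (L : ℝ) ^ d)) with he534
  set ρ' : ℝ := ((∑ y, r y) / (γA - rmax) + T / 2) with hρ'
  have hb0 : (0 : ℝ) ≤ b := zero_le_one.trans hb
  have hγb_le : γ * b ≤ b := by nlinarith
  -- the two z-integrands and the ξ-side factors
  set IF : (B1Eq324BenfattoLemma.Site d → ℝ) → ℝ := fun z => (smallFieldOn (corridors L w B : Set (B1Eq324BenfattoLemma.Site d)) I (γ * b)).indicator (fun _ => (1 : ℝ)) z *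
          Real.exp (hamiltonian s D κ a (corridors L w B) z) *
      ((smallFieldOn (out L B) I b).indicator (fun _ => (1 : ℝ)) z *
        ∏ m ∈ B, (smallFieldOn (frame1 L w m : Set (B1Eq324BenfattoLemma.Site d)) I (γ * b)).indicator (fun _ => (1 : ℝ)) z *
              (smallFieldOn (shrink L m w : Set (B1Eq324BenfattoLemma.Site d)) I b).indicator (fun _ => (1 : ℝ)) z * Real.exp (psiBox s D κ a L w m z))
    with hIF
  set IG : (B1Eq324BenfattoLemma.Site d → ℝ) → ℝ := fun z => (smallFieldOn (corridors L w B : Set (B1Eq324BenfattoLemma.Site d)) I (γ * b)).indicator (fun _ => (1 : ℝ)) z *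
          Real.exp (hamiltonian s D κ a (corridors L w B) z) *
      ((smallFieldOn (out L B) I b).indicator (fun _ => (1 : ℝ)) z *
        ∏ m ∈ B, (smallFieldOn (frame1 L w m : Set (B1Eq324BenfattoLemma.Site d)) I (γ * b)).indicator (fun _ => (1 : ℝ)) z *
              (smallFieldOn (shrink L m w : Set (B1Eq324BenfattoLemma.Site d)) I b).indicator (fun _ => (1 : ℝ)) z * Real.exp (psi1p s D κ a L w v m z + psi2 s D κ a L w m z))
    with hIG
  set pre : (B1Eq324BenfattoLemma.Site d → ℝ) → ℝ := fun ξ =>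
    (smallFieldOn (corridors L w B : Set (B1Eq324BenfattoLemma.Site d)) I (γ * b)).indicator (fun _ => (1 : ℝ)) ξ *
          Real.exp (hamiltonian s D κ a (corridors L w B) ξ) with hpre
  set OUT : (B1Eq324BenfattoLemma.Site d → ℝ) → ℝ := fun ξ =>
    ∫ z, (smallFieldOn (out L B) I b).indicator (fun _ => (1 : ℝ)) z ∂((gaussianFieldOfKernel Kout).map
              fun (ζ : B1Eq324BenfattoLemma.Site d → ℝ) (x : B1Eq324BenfattoLemma.Site d) => condMean K (C ∪ corridors L w B) ξ x + ζ x) with hOUT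
  set F : B1Eq324BenfattoLemma.Site d → (B1Eq324BenfattoLemma.Site d → ℝ) → ℝ := fun m ξ =>
    ∫ z, (smallFieldOn (frame1 L w m : Set (B1Eq324BenfattoLemma.Site d)) I (γ * b)).indicator (fun _ => (1 : ℝ)) z *
              (smallFieldOn (shrink L m w : Set (B1Eq324BenfattoLemma.Site d)) I b).indicator (fun _ => (1 : ℝ)) z * Real.exp (psiBox s D κ a L w m z) ∂((gaussianFieldOfKernel (Kb m)).map
              fun (ζ : B1Eq324BenfattoLemma.Site d → ℝ) (x : B1Eq324BenfattoLemma.Site d) => condMean K (C ∪ corridors L w B) ξ x + ζ x) with hF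
  set G : B1Eq324BenfattoLemma.Site d → (B1Eq324BenfattoLemma.Site d → ℝ) → ℝ := fun m ξ =>
    ∫ z, (smallFieldOn (frame1 L w m : Set (B1Eq324BenfattoLemma.Site d)) I (γ * b)).indicator (fun _ => (1 : ℝ)) z *
              (smallFieldOn (shrink L m w : Set (B1Eq324BenfattoLemma.Site d)) I b).indicator (fun _ => (1 : ℝ)) z * Real.exp (psi1p s D κ a L w v m z + psi2 s D κ a L w m z) ∂((gaussianFieldOfKernel (Kb m)).map
              fun (ζ : B1Eq324BenfattoLemma.Site d → ℝ) (x : B1Eq324BenfattoLemma.Site d) => condMean K (C ∪ corridors L w B) ξ x + ζ x) with hG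
  have hWbF : ∀ m, ∀ z : B1Eq324BenfattoLemma.Site d → ℝ, (∀ x ∈ J, x ∈ box L m → |z x| ≤ b) →
      |psiBox s D κ a L w m z| ≤ 2 * s1Const s D d κ * Ac * b ^ D * (L : ℝ) ^ d := fun m z hz => abs_psiBox_le_local hκ hJ hAc0 hAc hb hz
  have hWbG : ∀ m, ∀ z : B1Eq324BenfattoLemma.Site d → ℝ, (∀ x ∈ J, x ∈ box L m → |z x| ≤ b) →
      |psi1p s D κ a L w v m z + psi2 s D κ a L w m z| ≤ 8 * (s1Const s D d κ * Ac * b ^ D * (L : ℝ) ^ d) :=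
    fun m z hz => abs_psi1p_add_psi2_le_local hκ hJ hAc0 hAc hb hz
  have hzJ : ∀ z ∈ smallFieldSet I b, ∀ x ∈ J, |z x| ≤ b := fun z hz x hx => by
    have h := hz x
    rwa [distToRegion_eq_zero_of_mem (hJI hx), add_zero, mul_one] at h
  have hzJ' : ∀ z ∈ smallFieldSet I (γ * b), ∀ x ∈ J, |z x| ≤ γ * b := fun z hz x hx => by
    have h := hz x
    rwa [distToRegion_eq_zero_of_mem (hJI hx), add_zero, mul_one] at h
  -- U1: (5.11) upwards, pointwise
  have hU1pt : ∀ z, cutoffBoltzmann (hamiltonian s D κ a J) I (γ * b) z ≤ Real.exp e511 * cutoffBoltzmann (hatH s D κ a L w B) I (γ * b) z := by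
    intro z
    simp only [cutoffBoltzmann]
    by_cases hz : z ∈ smallFieldSet I (γ * b)
    · rw [Set.indicator_of_mem hz, Set.indicator_of_mem hz, ← Real.exp_add, Real.exp_le_exp]
      have h511 := abs_Hl_le_of_range hκ hJ hAc0 hAc hL hB hγb (hzJ' z hz) (s := s) (D := D) (w := w)
      have hsplit := hamiltonian_eq_hatH_add_Hl s D κ a J L w B z
      have := (abs_le.mp h511).2
      linarith
    · rw [Set.indicator_of_notMem hz, Set.indicator_of_notMem hz, mul_zero]
  -- U2: the factorised form at `γ` dominates `Π_Δχ̂^{γb}_Δ e^{Ĥ}` pointwise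
  have hU2pt : ∀ z, cutoffBoltzmann (hatH s D κ a L w B) I (γ * b) z ≤ IF z := by
    intro z
    have hF' : cutoffBoltzmann (hatH s D κ a L w B) I (γ * b) z = (smallFieldSet I (γ * b)).indicator (fun _ => (1 : ℝ)) z *
        Real.exp (hatH s D κ a L w B z) := by
      rw [cutoffBoltzmann]
      by_cases hz : z ∈ smallFieldSet I (γ * b)
      · rw [Set.indicator_of_mem hz, Set.indicator_of_mem hz, one_mul]
      · rw [Set.indicator_of_notMem hz, Set.indicator_of_notMem hz, zero_mul]
    have hIFeq : IF z = ((smallFieldOn (corridors L w B : Set (B1Eq324BenfattoLemma.Site d)) I (γ * b)).indicator (fun _ => (1 : ℝ)) z *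
        ((smallFieldOn (out L B) I b).indicator (fun _ => (1 : ℝ)) z *
          ∏ m ∈ B, ((smallFieldOn (frame1 L w m : Set (B1Eq324BenfattoLemma.Site d)) I (γ * b)).indicator (fun _ => (1 : ℝ)) z *
              (smallFieldOn (shrink L m w : Set (B1Eq324BenfattoLemma.Site d)) I b).indicator (fun _ => (1 : ℝ)) z))) *
        (Real.exp (hamiltonian s D κ a (corridors L w B) z) * ∏ m ∈ B, Real.exp (psiBox s D κ a L w m z)) := by
      simp only [hIF]
      rw [Finset.prod_mul_distrib]
      ring
    rw [hF', hIFeq, exp_hatH_eq]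
    exact mul_le_mul_of_nonneg_right (indicator_smallFieldSet_le_prod_gamma L w B I hγ1 hb0 z)
      (mul_nonneg (Real.exp_pos _).le (Finset.prod_nonneg fun m _ => (Real.exp_pos _).le))
  have hIFint : Integrable IF ((gaussianFieldOfKernel (condCov K C)).map
          fun (ζ : B1Eq324BenfattoLemma.Site d → ℝ) (x : B1Eq324BenfattoLemma.Site d) => condMean K C zbar x + ζ x) :=
    integrable_boxes_integrand_of hκ hJ hAc0 hAc hJI B hγ1 hb (fun m z => psiBox s D κ a L w m z) (fun m => measurable_psiBox L w m) hWbF _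
  have hU12 : ∫ z, cutoffBoltzmann (hamiltonian s D κ a J) I (γ * b) z ∂((gaussianFieldOfKernel (condCov K C)).map
          fun (ζ : B1Eq324BenfattoLemma.Site d → ℝ) (x : B1Eq324BenfattoLemma.Site d) => condMean K C zbar x + ζ x) ≤
      Real.exp e511 * ∫ z, IF z ∂((gaussianFieldOfKernel (condCov K C)).map
          fun (ζ : B1Eq324BenfattoLemma.Site d → ℝ) (x : B1Eq324BenfattoLemma.Site d) => condMean K C zbar x + ζ x) := by
    rw [← integral_const_mul]
    refine integral_mono_of_nonneg (Filter.Eventually.of_forall fun z => ?_) (hIFint.const_mul _)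
      (Filter.Eventually.of_forall fun z => (hU1pt z).trans (mul_le_mul_of_nonneg_left (hU2pt z) (Real.exp_pos _).le))
    rw [cutoffBoltzmann]
    exact Set.indicator_nonneg (fun _ _ => (Real.exp_pos _).le) _
  -- the class comparison, forwards (W = Ψ_□) and backwards (W = Ψ′₁ + Ψ₂)
  have hfacF : ∫ z, IF z ∂((gaussianFieldOfKernel (condCov K C)).map
          fun (ζ : B1Eq324BenfattoLemma.Site d → ℝ) (x : B1Eq324BenfattoLemma.Site d) => condMean K C zbar x + ζ x) ≤ Real.exp ρ' * ∫ ξ, pre ξ * (OUT ξ * ∏ m ∈ B, F m ξ) ∂((gaussianFieldOfKernel (condCov K C)).map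
          fun (ζ : B1Eq324BenfattoLemma.Site d → ℝ) (x : B1Eq324BenfattoLemma.Site d) => condMean K C zbar x + ζ x) :=
    integral_boxes_factorise_cond_le hK hAs hγA0 hγA hJI hL hγ1 hb hSΛ hBΛ π hπ r hr hrmax hγr hKb hKout hu hT hκ hJ hAc0 hAc (fun m z => psiBox s D κ a L w m z)
      (fun m z z' h => psiBox_congr_eqOn L w m h) (fun m => measurable_psiBox L w m) hWbF zbar hzbar
  have hfacG : Real.exp (-ρ') * ∫ ξ, pre ξ * (OUT ξ * ∏ m ∈ B, G m ξ) ∂((gaussianFieldOfKernel (condCov K C)).map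
          fun (ζ : B1Eq324BenfattoLemma.Site d → ℝ) (x : B1Eq324BenfattoLemma.Site d) => condMean K C zbar x + ζ x) ≤ ∫ z, IG z ∂((gaussianFieldOfKernel (condCov K C)).map
          fun (ζ : B1Eq324BenfattoLemma.Site d → ℝ) (x : B1Eq324BenfattoLemma.Site d) => condMean K C zbar x + ζ x) :=
    integral_boxes_factorise_cond_ge hK hAs hγA0 hγA hJI hL hγ1 hb hSΛ hBΛ π hπ r hr hrmax hγr hKb hKout hu hT hκ hJ hAc0 hAc (fun m z => psi1p s D κ a L w v m z + psi2 s D κ a L w m z)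
      (fun m z z' h => psi1p_add_psi2_congr_eqOn L w v m h) (fun m => measurable_psi1p_add_psi2 L w v m) hWbG zbar hzbar
  have hfacG' : ∫ ξ, pre ξ * (OUT ξ * ∏ m ∈ B, G m ξ) ∂((gaussianFieldOfKernel (condCov K C)).map
          fun (ζ : B1Eq324BenfattoLemma.Site d → ℝ) (x : B1Eq324BenfattoLemma.Site d) => condMean K C zbar x + ζ x) ≤ Real.exp ρ' * ∫ z, IG z ∂((gaussianFieldOfKernel (condCov K C)).map
          fun (ζ : B1Eq324BenfattoLemma.Site d → ℝ) (x : B1Eq324BenfattoLemma.Site d) => condMean K C zbar x + ζ x) := by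
    have h := mul_le_mul_of_nonneg_left hfacG (Real.exp_pos ρ').le
    rwa [← mul_assoc, ← Real.exp_add, add_neg_cancel, Real.exp_zero, one_mul] at h
  -- U3: the per-box upper bounds inside the ξ-integral (a.s.: the datum is `z̄` on `C`)
  have hparts := integrable_partIntegrals_cond hK hA hκ hJ hAc0 hAc hJI hγ1 hb hSΛ hBΛ hKb hKout
    (fun m z => psi1p s D κ a L w v m z + psi2 s D κ a L w m z) (fun m => measurable_psi1p_add_psi2 L w v m) hWbG zbar
  have hpre0 : ∀ ξ, 0 ≤ pre ξ := fun ξ => mul_nonneg (indicator_smallFieldOn_mem_Icc _ I _ ξ).1 (Real.exp_pos _).le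
  have hOUT0 : ∀ ξ, 0 ≤ OUT ξ := fun ξ => integral_nonneg fun z => (indicator_smallFieldOn_mem_Icc _ I b z).1
  have hboxObs0 : ∀ (m : B1Eq324BenfattoLemma.Site d) (W : (B1Eq324BenfattoLemma.Site d → ℝ) → ℝ) (z : B1Eq324BenfattoLemma.Site d → ℝ),
      0 ≤ (smallFieldOn (frame1 L w m : Set (B1Eq324BenfattoLemma.Site d)) I (γ * b)).indicator (fun _ => (1 : ℝ)) z *
        (smallFieldOn (shrink L m w : Set (B1Eq324BenfattoLemma.Site d)) I b).indicator (fun _ => (1 : ℝ)) z * Real.exp (W z) := fun m W z =>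
    mul_nonneg (mul_nonneg (indicator_smallFieldOn_mem_Icc _ I _ z).1 (indicator_smallFieldOn_mem_Icc _ I _ z).1) (Real.exp_pos _).le
  have hG0 : ∀ m ξ, 0 ≤ G m ξ := fun m ξ =>
    integral_nonneg fun z => hboxObs0 m (fun z => psi1p s D κ a L w v m z + psi2 s D κ a L w m z) z
  have hF0 : ∀ m ξ, 0 ≤ F m ξ := fun m ξ => integral_nonneg fun z => hboxObs0 m (fun z => psiBox s D κ a L w m z) z
  have hbox' : ∀ m ∈ B, ∀ ξ, ξ ∈ smallFieldOn (corridors L w B : Set (B1Eq324BenfattoLemma.Site d)) I (γ * b) →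
      ξ ∈ smallFieldOn (C : Set (B1Eq324BenfattoLemma.Site d)) I b → F m ξ ≤ Real.exp (u m) * G m ξ := by
    intro m hm ξ hξ hξC
    simp only [hF, hG]
    rw [boxFactor_eq_setIntegral_cond hK hA hSΛ hBΛ hL hKb hm _ hξ, boxFactor_eq_setIntegral_cond hK hA hSΛ hBΛ hL hKb hm _ hξ]
    exact hbox m hm ξ hξ hξC
  have h3pt : ∀ ξ, ξ ∈ smallFieldOn (C : Set (B1Eq324BenfattoLemma.Site d)) I b →
      pre ξ * (OUT ξ * ∏ m ∈ B, F m ξ) ≤ Real.exp (∑ m ∈ B, u m) * (pre ξ * (OUT ξ * ∏ m ∈ B, G m ξ)) := by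
    intro ξ hξC
    by_cases hξ : ξ ∈ smallFieldOn (corridors L w B : Set (B1Eq324BenfattoLemma.Site d)) I (γ * b)
    swap
    · have hpre' : pre ξ = 0 := by
        simp only [hpre]
        rw [Set.indicator_of_notMem hξ, zero_mul]
      rw [hpre', zero_mul, zero_mul, mul_zero]
    rw [Real.exp_sum]
    have hprod : ∏ m ∈ B, F m ξ ≤ (∏ m ∈ B, Real.exp (u m)) * ∏ m ∈ B, G m ξ := by
      rw [← Finset.prod_mul_distrib]
      exact Finset.prod_le_prod (fun m _ => hF0 m ξ) fun m hm => hbox' m hm ξ hξ hξC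
    calc pre ξ * (OUT ξ * ∏ m ∈ B, F m ξ) ≤ pre ξ * (OUT ξ * ((∏ m ∈ B, Real.exp (u m)) * ∏ m ∈ B, G m ξ)) :=
          mul_le_mul_of_nonneg_left (mul_le_mul_of_nonneg_left hprod (hOUT0 ξ)) (hpre0 ξ)
      _ = (∏ m ∈ B, Real.exp (u m)) * (pre ξ * (OUT ξ * ∏ m ∈ B, G m ξ)) := by ring
  have haeC : ∀ᵐ ξ ∂((gaussianFieldOfKernel (condCov K C)).map
          fun (ζ : B1Eq324BenfattoLemma.Site d → ℝ) (x : B1Eq324BenfattoLemma.Site d) => condMean K C zbar x + ζ x), ξ ∈ smallFieldOn (C : Set (B1Eq324BenfattoLemma.Site d)) I b := by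
    filter_upwards [condFieldK_ae_eqOn hKpsd C hdetC zbar] with ξ hξ x hx
    rw [hξ x (Finset.mem_coe.mp hx)]
    exact hzbar x hx
  have hFparts := integrable_partIntegrals_cond hK hA hκ hJ hAc0 hAc hJI hγ1 hb hSΛ hBΛ hKb hKout
    (fun m z => psiBox s D κ a L w m z) (fun m => measurable_psiBox L w m) hWbF zbar
  have hU3 : ∫ ξ, pre ξ * (OUT ξ * ∏ m ∈ B, F m ξ) ∂((gaussianFieldOfKernel (condCov K C)).map
          fun (ζ : B1Eq324BenfattoLemma.Site d → ℝ) (x : B1Eq324BenfattoLemma.Site d) => condMean K C zbar x + ζ x)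
      ≤ Real.exp (∑ m ∈ B, u m) * ∫ ξ, pre ξ * (OUT ξ * ∏ m ∈ B, G m ξ) ∂((gaussianFieldOfKernel (condCov K C)).map
          fun (ζ : B1Eq324BenfattoLemma.Site d → ℝ) (x : B1Eq324BenfattoLemma.Site d) => condMean K C zbar x + ζ x) := by
    rw [← integral_const_mul]
    refine integral_mono_ae hFparts.1 (hparts.1.const_mul _) ?_
    filter_upwards [haeC] with ξ hξC
    exact h3pt ξ hξC
  -- U4: (5.34) upwards, pointwise, then integrated
  have hU4pt : ∀ z, IG z ≤ Real.exp e534 * cutoffBoltzmann (hamiltonian s D κ a (corridorsBar L w v B)) I b z := by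
    intro z
    have hIGeq : IG z = ((smallFieldOn (corridors L w B : Set (B1Eq324BenfattoLemma.Site d)) I (γ * b)).indicator (fun _ => (1 : ℝ)) z *
        ((smallFieldOn (out L B) I b).indicator (fun _ => (1 : ℝ)) z *
          ∏ m ∈ B, (smallFieldOn (shrink L m w : Set (B1Eq324BenfattoLemma.Site d)) I b).indicator (fun _ => (1 : ℝ)) z)) *
        (∏ m ∈ B, (smallFieldOn (frame1 L w m : Set (B1Eq324BenfattoLemma.Site d)) I (γ * b)).indicator (fun _ => (1 : ℝ)) z) *
        Real.exp (hamiltonian s D κ a (corridors L w B) z + ∑ m ∈ B, (psi1p s D κ a L w v m z + psi2 s D κ a L w m z)) := by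
      simp only [hIG]
      rw [Real.exp_add, Real.exp_sum, Finset.prod_mul_distrib, Finset.prod_mul_distrib]
      ring
    rw [hIGeq, cutoffBoltzmann]
    have hP := prod_indicator_le_indicator_smallFieldSet L w B I (γ := γ) (b := b) hγ1 hb0 z
    have hQ1 : ∏ m ∈ B, (smallFieldOn (frame1 L w m : Set (B1Eq324BenfattoLemma.Site d)) I (γ * b)).indicator (fun _ => (1 : ℝ)) z ≤ 1 :=
      Finset.prod_le_one (fun m _ => (indicator_smallFieldOn_mem_Icc _ I _ z).1) fun m _ => (indicator_smallFieldOn_mem_Icc _ I _ z).2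
    have hQ0 : 0 ≤ ∏ m ∈ B, (smallFieldOn (frame1 L w m : Set (B1Eq324BenfattoLemma.Site d)) I (γ * b)).indicator (fun _ => (1 : ℝ)) z :=
      Finset.prod_nonneg fun m _ => (indicator_smallFieldOn_mem_Icc _ I _ z).1
    by_cases hz : z ∈ smallFieldSet I b
    · rw [Set.indicator_of_mem hz, ← Real.exp_add]
      have h534 := abs_hamiltonian_corridorsBar_sub_sum_psi_le hκ hJ hAc0 hAc hL hv hb (hzJ z hz) (B := B) (s := s) (D := D)
      have hexp : Real.exp (hamiltonian s D κ a (corridors L w B) z + ∑ m ∈ B, (psi1p s D κ a L w v m z + psi2 s D κ a L w m z))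
          ≤ Real.exp (e534 + hamiltonian s D κ a (corridorsBar L w v B) z) := by
        rw [Real.exp_le_exp]
        have := (abs_le.mp h534).1
        simp only [he534]
        linarith
      have hPQ : (smallFieldOn (corridors L w B : Set (B1Eq324BenfattoLemma.Site d)) I (γ * b)).indicator (fun _ => (1 : ℝ)) z *
          ((smallFieldOn (out L B) I b).indicator (fun _ => (1 : ℝ)) z *
            ∏ m ∈ B, (smallFieldOn (shrink L m w : Set (B1Eq324BenfattoLemma.Site d)) I b).indicator (fun _ => (1 : ℝ)) z) *
          (∏ m ∈ B, (smallFieldOn (frame1 L w m : Set (B1Eq324BenfattoLemma.Site d)) I (γ * b)).indicator (fun _ => (1 : ℝ)) z) ≤ 1 := by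
        rw [Set.indicator_of_mem hz] at hP
        exact mul_le_one₀ hP hQ0 hQ1
      calc _ ≤ 1 * Real.exp (e534 + hamiltonian s D κ a (corridorsBar L w v B) z) :=
            mul_le_mul hPQ hexp (Real.exp_pos _).le zero_le_one
        _ = _ := by rw [one_mul]
    · rw [Set.indicator_of_notMem hz] at hP ⊢
      rw [mul_zero]
      have h0 : (smallFieldOn (corridors L w B : Set (B1Eq324BenfattoLemma.Site d)) I (γ * b)).indicator (fun _ => (1 : ℝ)) z *
          ((smallFieldOn (out L B) I b).indicator (fun _ => (1 : ℝ)) z *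
            ∏ m ∈ B, (smallFieldOn (shrink L m w : Set (B1Eq324BenfattoLemma.Site d)) I b).indicator (fun _ => (1 : ℝ)) z) = 0 :=
        le_antisymm hP (mul_nonneg (indicator_smallFieldOn_mem_Icc _ I _ z).1 (mul_nonneg (indicator_smallFieldOn_mem_Icc _ I _ z).1
          (Finset.prod_nonneg fun m _ => (indicator_smallFieldOn_mem_Icc _ I _ z).1)))
      rw [h0, zero_mul, zero_mul]
  have hZint : Integrable (fun z => cutoffBoltzmann (hamiltonian s D κ a (corridorsBar L w v B)) I b z) ((gaussianFieldOfKernel (condCov K C)).map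
          fun (ζ : B1Eq324BenfattoLemma.Site d → ℝ) (x : B1Eq324BenfattoLemma.Site d) => condMean K C zbar x + ζ x) := by
    refine Integrable.of_bound (measurable_cutoffBoltzmann_hamiltonian a _ I b).aestronglyMeasurable
      (Real.exp (s1Const s D d κ * Ac * b ^ D * (corridorsBar L w v B).card)) (ae_of_all _ fun z => ?_)
    rw [Real.norm_eq_abs, cutoffBoltzmann]
    by_cases hz : z ∈ smallFieldSet I b
    · rw [Set.indicator_of_mem hz, Real.abs_exp, Real.exp_le_exp]
      exact (le_abs_self _).trans (abs_hamiltonian_le hκ hJ hAc0 hAc _ hb (hzJ z hz))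
    · rw [Set.indicator_of_notMem hz, abs_zero]
      exact (Real.exp_pos _).le
  have hU4 : ∫ z, IG z ∂((gaussianFieldOfKernel (condCov K C)).map
          fun (ζ : B1Eq324BenfattoLemma.Site d → ℝ) (x : B1Eq324BenfattoLemma.Site d) => condMean K C zbar x + ζ x) ≤ Real.exp e534 * ∫ z, cutoffBoltzmann (hamiltonian s D κ a (corridorsBar L w v B)) I b z ∂((gaussianFieldOfKernel (condCov K C)).map
          fun (ζ : B1Eq324BenfattoLemma.Site d → ℝ) (x : B1Eq324BenfattoLemma.Site d) => condMean K C zbar x + ζ x) := by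
    rw [← integral_const_mul]
    refine integral_mono_of_nonneg (Filter.Eventually.of_forall fun z => ?_) (hZint.const_mul _) (Filter.Eventually.of_forall hU4pt)
    exact mul_nonneg (mul_nonneg (indicator_smallFieldOn_mem_Icc _ I _ z).1 (Real.exp_pos _).le)
      (mul_nonneg (indicator_smallFieldOn_mem_Icc _ I _ z).1 (Finset.prod_nonneg fun m _ =>
        hboxObs0 m (fun z => psi1p s D κ a L w v m z + psi2 s D κ a L w m z) z))
  -- U5: the next datum
  have h5 : ∫ z, cutoffBoltzmann (hamiltonian s D κ a (corridorsBar L w v B)) I b z ∂((gaussianFieldOfKernel (condCov K C)).map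
          fun (ζ : B1Eq324BenfattoLemma.Site d → ℝ) (x : B1Eq324BenfattoLemma.Site d) => condMean K C zbar x + ζ x)
      = ∫ z, cutoffBoltzmann (hamiltonian s D κ (restrictCoef a (corridorsBar L w v B)) (J ∩ corridorsBar L w v B)) I b z ∂((gaussianFieldOfKernel (condCov K C)).map
          fun (ζ : B1Eq324BenfattoLemma.Site d → ℝ) (x : B1Eq324BenfattoLemma.Site d) => condMean K C zbar x + ζ x) :=
    integral_congr_ae (Filter.Eventually.of_forall fun z => cutoffBoltzmann_hamiltonian_eq_restrict hJ _ I b z)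
  -- chain
  rw [← h5]
  calc ∫ z, cutoffBoltzmann (hamiltonian s D κ a J) I (γ * b) z ∂((gaussianFieldOfKernel (condCov K C)).map
          fun (ζ : B1Eq324BenfattoLemma.Site d → ℝ) (x : B1Eq324BenfattoLemma.Site d) => condMean K C zbar x + ζ x)
      ≤ Real.exp e511 * ∫ z, IF z ∂((gaussianFieldOfKernel (condCov K C)).map
          fun (ζ : B1Eq324BenfattoLemma.Site d → ℝ) (x : B1Eq324BenfattoLemma.Site d) => condMean K C zbar x + ζ x) := hU12
    _ ≤ Real.exp e511 * (Real.exp ρ' * ∫ ξ, pre ξ * (OUT ξ * ∏ m ∈ B, F m ξ) ∂((gaussianFieldOfKernel (condCov K C)).map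
          fun (ζ : B1Eq324BenfattoLemma.Site d → ℝ) (x : B1Eq324BenfattoLemma.Site d) => condMean K C zbar x + ζ x)) :=
        mul_le_mul_of_nonneg_left hfacF (Real.exp_pos _).le
    _ ≤ Real.exp e511 * (Real.exp ρ' * (Real.exp (∑ m ∈ B, u m) * ∫ ξ, pre ξ * (OUT ξ * ∏ m ∈ B, G m ξ) ∂((gaussianFieldOfKernel (condCov K C)).map
          fun (ζ : B1Eq324BenfattoLemma.Site d → ℝ) (x : B1Eq324BenfattoLemma.Site d) => condMean K C zbar x + ζ x))) :=
        mul_le_mul_of_nonneg_left (mul_le_mul_of_nonneg_left hU3 (Real.exp_pos _).le) (Real.exp_pos _).le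
    _ ≤ Real.exp e511 * (Real.exp ρ' * (Real.exp (∑ m ∈ B, u m) * (Real.exp ρ' * ∫ z, IG z ∂((gaussianFieldOfKernel (condCov K C)).map
          fun (ζ : B1Eq324BenfattoLemma.Site d → ℝ) (x : B1Eq324BenfattoLemma.Site d) => condMean K C zbar x + ζ x)))) :=
        mul_le_mul_of_nonneg_left (mul_le_mul_of_nonneg_left (mul_le_mul_of_nonneg_left hfacG' (Real.exp_pos _).le)
          (Real.exp_pos _).le) (Real.exp_pos _).le
    _ ≤ Real.exp e511 * (Real.exp ρ' * (Real.exp (∑ m ∈ B, u m) * (Real.exp ρ' *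
          (Real.exp e534 * ∫ z, cutoffBoltzmann (hamiltonian s D κ a (corridorsBar L w v B)) I b z ∂((gaussianFieldOfKernel (condCov K C)).map
          fun (ζ : B1Eq324BenfattoLemma.Site d → ℝ) (x : B1Eq324BenfattoLemma.Site d) => condMean K C zbar x + ζ x))))) :=
        mul_le_mul_of_nonneg_left (mul_le_mul_of_nonneg_left (mul_le_mul_of_nonneg_left
          (mul_le_mul_of_nonneg_left hU4 (Real.exp_pos _).le) (Real.exp_pos _).le) (Real.exp_pos _).le) (Real.exp_pos _).le
    _ = _ := by
        have hsplit : Real.exp (e511 + e534 + 2 * ρ' + ∑ m ∈ B, u m) =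
            Real.exp e511 * (Real.exp ρ' * (Real.exp (∑ m ∈ B, u m) * (Real.exp ρ' * Real.exp e534))) := by
          rw [← Real.exp_add, ← Real.exp_add, ← Real.exp_add, ← Real.exp_add]
          congr 1
          ring
        rw [hsplit]
        ring

end Main

end Literature.MathematicalPhysics.QuantumFieldTheory.Balaban1983to89.B1Eq324BenfattoKernelSect5UpperStep

end
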